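import Literature.MathematicalPhysics.KineticTheory.HarmonicChainCovariance
import Mathlib.Algebra.Algebra.Spectrum.Basic
import Mathlib.MeasureTheory.Integral.IntervalIntegral.FundThmCalculus
import Mathlib.MeasureTheory.Integral.IntegralEqImproper
import Mathlib.Analysis.SpecialFunctions.Trigonometric.ArctanDeriv
import Mathlib.Analysis.SpecialFunctions.Log.Deriv
import Mathlib.Analysis.Complex.RealDeriv
import Mathlib.Analysis.Normed.Field.Lemmas
import Mathlib.LinearAlgebra.Eigenspace.Triangularizable
import Mathlib.Topology.Instances.Matrix
import HarnessLib

/-!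
# The frequency-domain solution of the Lyapunov equation

Trunk T-KINETIC (Literature/MathematicalPhysics/KineticTheory), generic linear-algebra/analysis
companion of `HarmonicChainCovariance.lean` (`IsHurwitz`, `lyapSol`). For a real Hurwitz matrix
`A` and any real `S`, the solution `X = lyapSol A S` of `A X + X Aᵀ + S = 0` has the frequency
representation

`X = (1/2π) ∫_ℝ (iω - A)⁻¹ S (iω - A)^{-*} dω`

(the stationary covariance of `dx = Ax dt + σ dW`, `S = σσᵀ`, as the integral of the spectral
density `R(ω) S R(ω)*`; Dhar 2008 §3.2 writes the velocity correlations of the harmonic chain in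
exactly this form, `K = (k_BT_L/π)∫ dω ω² G⁺Γ_L G⁻ + …`). This file PROVES it in the form that is
needed downstream (the Casher–Lebowitz current formula,
`Literature/Barriers/AtomisticToContinuum/DisorderedHarmonicChainSpectral.lean`): for every entry,
the symmetric improper integrals `Re ∫_{-T}^{T} (R(ω) S R(ω)*)_{ij} dω` converge to `2π X_{ij}` as
`T → ∞` (`IsHurwitz.tendsto_re_densityIntegral`), and for `S = diag(d)`, `d ≥ 0`, the diagonal
spectral densities `∑_k d_k |R(ω)_{ik}|²` are integrable on `ℝ` with
`∫_ℝ ∑_k d_k |R(ω)_{ik}|² dω = 2π X_{ii}` (`IsHurwitz.integral_resolvent_diagonal`).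

## Proof

Pointwise `A (RSR*) + (RSR*) Aᵀ = -(S R* + R S)` (resolvent identity `A R = iω R - 1`), so after
integration over `[-T, T]` the Lyapunov operator applied to `X_T = ∫_{-T}^T RSR*` is
`-(S Y_T* + Y_T S)` with `Y_T = ∫_{-T}^T R(ω) dω`; and `Y_T → π·1`: on a generalized eigenvector
`w`, `(A - μ)^k w = 0`, the resolvent is the finite sum `R(ω) w = ∑_{j<k} (iω - μ)^{-(j+1)} (A - μ)^j w`,
the scalar integrals satisfy `∫_{-T}^T (iω - μ)⁻¹ dω → π` (`Re μ < 0`) and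
`∫_{-T}^T (iω - μ)^{-(j+2)} dω → 0`, and generalized eigenvectors span `ℂⁿ`
(`Module.End.iSup_maxGenEigenspace_eq_top`). Since the Lyapunov operator is a linear
homeomorphism (finite dimension, injective for Hurwitz `A`), `Re X_T → 2π · lyapSol A S`.
No matrix exponential, Plancherel or contour integration is used.

## Contents

* `charLine A ω = iω·1 - A` over `ℂ`, `resolventI A ω = (charLine A ω)⁻¹`; for Hurwitz `A`:
  `det_charLine_ne_zero`, `charLine_mul_resolventI`, `resolventI_mul_charLine`, the resolvent
  identities, `continuous_resolventI`.
* Scalar integrals: `inv_I_mul_sub_eq` (real/imaginary parts of `(iω - μ)⁻¹`),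
  `tendsto_intervalIntegral_inv_I_mul_sub` (`→ π`), `tendsto_intervalIntegral_inv_I_mul_sub_pow`
  (`→ 0`).
* `IsHurwitz.resolventI_mulVec_of_pow_apply_eq_zero` (finite expansion on generalized
  eigenvectors), `resolventIntegral A T = ∫_{-T}^T R` (entrywise),
  `IsHurwitz.tendsto_resolventIntegral_mulVec`, `IsHurwitz.tendsto_resolventIntegral_apply`
  (`→ π·1`).
* `resolventDensity A S ω = R S R*`, `IsHurwitz.lyapunov_resolventDensity` (pointwise identity),
  `densityIntegral A S T = ∫_{-T}^T R S R*` (entrywise), `IsHurwitz.lyapunov_densityIntegral`,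
  `IsHurwitz.lyapunovOp_re_densityIntegral`, `IsHurwitz.tendsto_re_densityIntegral` (the frequency
  representation of `lyapSol`), `resolventDensity_diagonal_apply_self`,
  `IsHurwitz.integral_resolvent_diagonal`.

## Design notes

* Everything is entrywise (scalar interval integrals), so no norm instance on matrices is chosen;
  continuity of the resolvent comes from `adjugate/det`.
* The statement is about symmetric improper integrals `∫_{-T}^{T}`: the off-diagonal entries of
  `R S R*` are `O(ω⁻²)` and integrable too, but only the non-negative diagonal densities are
  upgraded to Bochner integrals over `ℝ` here (monotone convergence via
  `integrable_of_intervalIntegral_norm_tendsto`), which is what the heat-current formula uses.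
-/

noncomputable section

open Matrix Complex MeasureTheory Filter Topology intervalIntegral Bornology
open scoped ComplexConjugate

namespace Literature.MathematicalPhysics.KineticTheory.HeatConduction

variable {ι : Type*} [Fintype ι] [DecidableEq ι]

/-! ### The resolvent on the imaginary axis -/

/-- `iω·1 - A` over `ℂ`, for a real square matrix `A` and a real frequency `ω`. [folklore] -/
def charLine (A : Matrix ι ι ℝ) (ω : ℝ) : Matrix ι ι ℂ :=
  (Complex.I * ω) • (1 : Matrix ι ι ℂ) - A.map (algebraMap ℝ ℂ)

/-- The resolvent `R(ω) = (iω - A)⁻¹` of a real square matrix on the imaginary axis (matrix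
inverse; junk `0` where `iω` is an eigenvalue, which never happens for Hurwitz `A`).
[folklore] -/
def resolventI (A : Matrix ι ι ℝ) (ω : ℝ) : Matrix ι ι ℂ :=
  (charLine A ω)⁻¹

/-- Unfolding `charLine` against a vector: `(iω - A) v = iω v - A v`. [folklore] -/
theorem charLine_mulVec (A : Matrix ι ι ℝ) (ω : ℝ) (v : ι → ℂ) :
    charLine A ω *ᵥ v = (Complex.I * ω) • v - A.map (algebraMap ℝ ℂ) *ᵥ v := by
  rw [charLine, sub_mulVec, smul_mulVec, one_mulVec]

/-- For a Hurwitz matrix, `iω - A` is invertible for every real `ω` (no eigenvalue on the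
imaginary axis). [folklore] -/
theorem IsHurwitz.det_charLine_ne_zero {A : Matrix ι ι ℝ} (hA : IsHurwitz A) (ω : ℝ) :
    (charLine A ω).det ≠ 0 := by
  intro h
  obtain ⟨v, hv, hMv⟩ := Matrix.exists_mulVec_eq_zero_iff.mpr h
  rw [charLine_mulVec, sub_eq_zero] at hMv
  have := hA (Complex.I * ω) v hv hMv.symm
  simp at this

/-- `(iω - A) R(ω) = 1`. [folklore] -/
theorem IsHurwitz.charLine_mul_resolventI {A : Matrix ι ι ℝ} (hA : IsHurwitz A) (ω : ℝ) :
    charLine A ω * resolventI A ω = 1 :=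
  mul_nonsing_inv _ (isUnit_iff_ne_zero.mpr (hA.det_charLine_ne_zero ω))

/-- `R(ω) (iω - A) = 1`. [folklore] -/
theorem IsHurwitz.resolventI_mul_charLine {A : Matrix ι ι ℝ} (hA : IsHurwitz A) (ω : ℝ) :
    resolventI A ω * charLine A ω = 1 :=
  nonsing_inv_mul _ (isUnit_iff_ne_zero.mpr (hA.det_charLine_ne_zero ω))

/-- Resolvent identity on the left: `A R(ω) = iω R(ω) - 1`. [folklore] -/
theorem IsHurwitz.map_mul_resolventI {A : Matrix ι ι ℝ} (hA : IsHurwitz A) (ω : ℝ) :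
    A.map (algebraMap ℝ ℂ) * resolventI A ω = (Complex.I * ω) • resolventI A ω - 1 := by
  have h := hA.charLine_mul_resolventI ω
  rw [charLine, sub_mul, smul_mul_assoc, one_mul] at h
  rw [← h]
  abel

/-- Resolvent identity on the right: `R(ω) A = iω R(ω) - 1`. [folklore] -/
theorem IsHurwitz.resolventI_mul_map {A : Matrix ι ι ℝ} (hA : IsHurwitz A) (ω : ℝ) :
    resolventI A ω * A.map (algebraMap ℝ ℂ) = (Complex.I * ω) • resolventI A ω - 1 := by
  have h := hA.resolventI_mul_charLine ω
  rw [charLine, mul_sub, mul_smul_comm, mul_one] at h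
  rw [← h]
  abel

omit [Fintype ι] in
/-- `ω ↦ iω - A` is continuous. [folklore] -/
theorem continuous_charLine (A : Matrix ι ι ℝ) : Continuous (charLine A) := by
  unfold charLine
  exact ((continuous_const.mul Complex.continuous_ofReal).smul continuous_const).sub
    continuous_const

/-- The resolvent of a Hurwitz matrix is continuous along the imaginary axis (adjugate over
determinant). [folklore] -/
theorem IsHurwitz.continuous_resolventI {A : Matrix ι ι ℝ} (hA : IsHurwitz A) :
    Continuous (resolventI A) := by
  have h : resolventI A = fun ω => ((charLine A ω).det)⁻¹ • (charLine A ω).adjugate := by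
    funext ω
    rw [resolventI, Matrix.inv_def, Ring.inverse_eq_inv']
  rw [h]
  exact ((continuous_charLine A).matrix_det.inv₀ hA.det_charLine_ne_zero).smul
    (continuous_charLine A).matrix_adjugate

/-- Each entry of the resolvent is continuous. [folklore] -/
theorem IsHurwitz.continuous_resolventI_apply {A : Matrix ι ι ℝ} (hA : IsHurwitz A) (i j : ι) :
    Continuous fun ω => resolventI A ω i j :=
  hA.continuous_resolventI.matrix_elem i j

/-! ### Scalar integrals along the imaginary axis -/

/-- Real and imaginary parts of `(iω - μ)⁻¹`:
`(iω - μ)⁻¹ = (-Re μ - (ω - Im μ) i)/((Re μ)² + (ω - Im μ)²)`. [folklore] -/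
theorem inv_I_mul_sub_eq (μ : ℂ) (ω : ℝ) :
    (Complex.I * ω - μ)⁻¹ =
      ((-μ.re / (μ.re ^ 2 + (ω - μ.im) ^ 2) : ℝ) : ℂ) +
        ((-(ω - μ.im) / (μ.re ^ 2 + (ω - μ.im) ^ 2) : ℝ) : ℂ) * Complex.I := by
  have hns : Complex.normSq (Complex.I * ω - μ) = μ.re ^ 2 + (ω - μ.im) ^ 2 := by
    simp [Complex.normSq_apply]
    ring
  have hre : (Complex.I * ω - μ).re = -μ.re := by simp
  have him : (Complex.I * ω - μ).im = ω - μ.im := by simp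
  apply Complex.ext
  · rw [Complex.inv_re, hns, hre]
    simp only [Complex.add_re, Complex.ofReal_re, Complex.mul_re, Complex.I_re, Complex.I_im,
      Complex.ofReal_im, mul_zero, zero_mul, sub_zero, add_zero]
  · rw [Complex.inv_im, hns, him]
    simp only [Complex.add_im, Complex.ofReal_im, Complex.mul_im, Complex.I_re, Complex.I_im,
      Complex.ofReal_re, mul_zero, mul_one, zero_add, add_zero, neg_div]

/-- `iω - μ ≠ 0` for real `ω` when `Re μ ≠ 0`. [folklore] -/
theorem I_mul_sub_ne_zero {μ : ℂ} (hμ : μ.re ≠ 0) (ω : ℝ) : Complex.I * ω - μ ≠ 0 := by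
  intro h
  have := congrArg Complex.re h
  simp at this
  exact hμ (by linarith)

/-- **`∫_{-T}^{T} dω/(iω - μ) → π`** as `T → ∞`, for `Re μ < 0`: the real part
`-Re μ/((Re μ)² + (ω - Im μ)²)` integrates to a difference of arctangents tending to `π`, the
imaginary part to `½ log` of a ratio tending to `1`. [folklore] -/
theorem tendsto_intervalIntegral_inv_I_mul_sub {μ : ℂ} (hμ : μ.re < 0) :
    Tendsto (fun T : ℝ => ∫ ω in (-T)..T, (Complex.I * ω - μ)⁻¹) atTop (𝓝 (Real.pi : ℂ)) := by
  set s : ℝ := -μ.re with hs_def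
  set b : ℝ := μ.im with hb_def
  have hs : 0 < s := by simp only [hs_def]; linarith
  have hD : ∀ ω : ℝ, 0 < s ^ 2 + (ω - b) ^ 2 := fun ω => by positivity
  -- the two real integrands
  have hfre_cont : Continuous fun ω : ℝ => s / (s ^ 2 + (ω - b) ^ 2) :=
    continuous_const.div (continuous_const.add ((continuous_id.sub continuous_const).pow 2))
      fun ω => (hD ω).ne'
  have hfim_cont : Continuous fun ω : ℝ => -(ω - b) / (s ^ 2 + (ω - b) ^ 2) :=
    (continuous_id.sub continuous_const).neg.div
      (continuous_const.add ((continuous_id.sub continuous_const).pow 2)) fun ω => (hD ω).ne'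
  have hdecomp : ∀ ω : ℝ, (Complex.I * ω - μ)⁻¹ =
      ((s / (s ^ 2 + (ω - b) ^ 2) : ℝ) : ℂ) +
        ((-(ω - b) / (s ^ 2 + (ω - b) ^ 2) : ℝ) : ℂ) * Complex.I := by
    intro ω
    rw [inv_I_mul_sub_eq]
    simp only [hs_def, hb_def, neg_sq]
  -- antiderivatives
  have hre : ∀ T : ℝ, ∫ ω in (-T)..T, s / (s ^ 2 + (ω - b) ^ 2) =
      Real.arctan ((T - b) / s) - Real.arctan ((-T - b) / s) := by
    intro T
    apply integral_eq_sub_of_hasDerivAt (f := fun y : ℝ => Real.arctan ((y - b) / s))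
    · intro x _
      have h1 : HasDerivAt (fun ω : ℝ => (ω - b) / s) (1 / s) x := by
        simpa using ((hasDerivAt_id x).sub_const b).div_const s
      refine ((Real.hasDerivAt_arctan ((x - b) / s)).comp x h1).congr_deriv ?_
      have hsx := (hD x).ne'
      have hs0 := hs.ne'
      field_simp
    · exact hfre_cont.intervalIntegrable _ _
  have him : ∀ T : ℝ, ∫ ω in (-T)..T, -(ω - b) / (s ^ 2 + (ω - b) ^ 2) =
      -(Real.log (s ^ 2 + (T - b) ^ 2) / 2) - -(Real.log (s ^ 2 + (-T - b) ^ 2) / 2) := by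
    intro T
    apply integral_eq_sub_of_hasDerivAt (f := fun y : ℝ => -(Real.log (s ^ 2 + (y - b) ^ 2) / 2))
    · intro x _
      have h1 : HasDerivAt (fun ω : ℝ => s ^ 2 + (ω - b) ^ 2) (2 * (x - b)) x := by
        have := (((hasDerivAt_id x).sub_const b).pow 2).const_add (s ^ 2)
        simpa using this
      refine ((((Real.hasDerivAt_log (hD x).ne').comp x h1).div_const 2).neg).congr_deriv ?_
      have hsx := (hD x).ne'
      field_simp
    · exact hfim_cont.intervalIntegrable _ _
  -- the complex integral in terms of the two real ones
  have hsplit : ∀ T : ℝ, ∫ ω in (-T)..T, (Complex.I * ω - μ)⁻¹ =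
      ((∫ ω in (-T)..T, s / (s ^ 2 + (ω - b) ^ 2) : ℝ) : ℂ) +
        ((∫ ω in (-T)..T, -(ω - b) / (s ^ 2 + (ω - b) ^ 2) : ℝ) : ℂ) * Complex.I := by
    intro T
    simp_rw [hdecomp]
    rw [intervalIntegral.integral_add, intervalIntegral.integral_ofReal,
      intervalIntegral.integral_mul_const, intervalIntegral.integral_ofReal]
    · exact (Complex.continuous_ofReal.comp hfre_cont).intervalIntegrable _ _
    · exact ((Complex.continuous_ofReal.comp hfim_cont).mul continuous_const).intervalIntegrable _ _
  -- limits of the real parts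
  have hlim_re : Tendsto (fun T : ℝ => ∫ ω in (-T)..T, s / (s ^ 2 + (ω - b) ^ 2)) atTop
      (𝓝 Real.pi) := by
    simp_rw [hre]
    have h1 : Tendsto (fun T : ℝ => Real.arctan ((T - b) / s)) atTop (𝓝 (Real.pi / 2)) := by
      have ht : Tendsto (fun T : ℝ => (T - b) / s) atTop atTop :=
        Tendsto.atTop_div_const hs (tendsto_atTop_add_const_right _ _ tendsto_id)
      exact (Real.tendsto_arctan_atTop.mono_right nhdsWithin_le_nhds).comp ht
    have h2 : Tendsto (fun T : ℝ => Real.arctan ((-T - b) / s)) atTop (𝓝 (-(Real.pi / 2))) := by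
      have ht : Tendsto (fun T : ℝ => (-T - b) / s) atTop atBot :=
        Tendsto.atBot_div_const hs (tendsto_atBot_add_const_right _ _ tendsto_neg_atTop_atBot)
      exact (Real.tendsto_arctan_atBot.mono_right nhdsWithin_le_nhds).comp ht
    have := h1.sub h2
    convert this using 2
    ring
  have hlim_im : Tendsto (fun T : ℝ => ∫ ω in (-T)..T, -(ω - b) / (s ^ 2 + (ω - b) ^ 2)) atTop
      (𝓝 0) := by
    simp_rw [him]
    -- the ratio `(s² + (T+b)²)/(s² + (T-b)²) → 1`
    have hratio : Tendsto (fun T : ℝ => (s ^ 2 + (-T - b) ^ 2) / (s ^ 2 + (T - b) ^ 2)) atTop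
        (𝓝 1) := by
      have hnum : Tendsto (fun T : ℝ => (s ^ 2 + (-T - b) ^ 2) / T ^ 2) atTop (𝓝 1) := by
        have e : ∀ᶠ T : ℝ in atTop, (s ^ 2 + (-T - b) ^ 2) / T ^ 2 =
            (s ^ 2 + b ^ 2) * (T ^ 2)⁻¹ + 2 * b * T⁻¹ + 1 := by
          filter_upwards [eventually_gt_atTop 0] with T hT
          field_simp
          ring
        rw [tendsto_congr' e]
        have h1 : Tendsto (fun T : ℝ => (T ^ 2)⁻¹) atTop (𝓝 0) :=
          (tendsto_pow_atTop two_ne_zero).inv_tendsto_atTop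
        have h2 : Tendsto (fun T : ℝ => T⁻¹) atTop (𝓝 0) := tendsto_inv_atTop_zero
        have := ((h1.const_mul (s ^ 2 + b ^ 2)).add (h2.const_mul (2 * b))).add
          (tendsto_const_nhds (x := (1 : ℝ)))
        simpa using this
      have hden : Tendsto (fun T : ℝ => (s ^ 2 + (T - b) ^ 2) / T ^ 2) atTop (𝓝 1) := by
        have e : ∀ᶠ T : ℝ in atTop, (s ^ 2 + (T - b) ^ 2) / T ^ 2 =
            (s ^ 2 + b ^ 2) * (T ^ 2)⁻¹ + (-(2 * b)) * T⁻¹ + 1 := by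
          filter_upwards [eventually_gt_atTop 0] with T hT
          field_simp
          ring
        rw [tendsto_congr' e]
        have h1 : Tendsto (fun T : ℝ => (T ^ 2)⁻¹) atTop (𝓝 0) :=
          (tendsto_pow_atTop two_ne_zero).inv_tendsto_atTop
        have h2 : Tendsto (fun T : ℝ => T⁻¹) atTop (𝓝 0) := tendsto_inv_atTop_zero
        have := ((h1.const_mul (s ^ 2 + b ^ 2)).add (h2.const_mul (-(2 * b)))).add
          (tendsto_const_nhds (x := (1 : ℝ)))
        simpa using this
      have e : ∀ᶠ T : ℝ in atTop, (s ^ 2 + (-T - b) ^ 2) / (s ^ 2 + (T - b) ^ 2) =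
          ((s ^ 2 + (-T - b) ^ 2) / T ^ 2) / ((s ^ 2 + (T - b) ^ 2) / T ^ 2) := by
        filter_upwards [eventually_gt_atTop 0] with T hT
        have hT2 : T ^ 2 ≠ 0 := by positivity
        field_simp
      rw [tendsto_congr' e]
      have h := hnum.div hden one_ne_zero
      rw [div_one] at h
      exact h
    have hlog : Tendsto (fun T : ℝ => Real.log ((s ^ 2 + (-T - b) ^ 2) / (s ^ 2 + (T - b) ^ 2)))
        atTop (𝓝 0) := by
      have := (Real.continuousAt_log one_ne_zero).tendsto.comp hratio
      rw [Real.log_one] at this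
      exact this
    have e : ∀ T : ℝ, -(Real.log (s ^ 2 + (T - b) ^ 2) / 2) - -(Real.log (s ^ 2 + (-T - b) ^ 2) / 2)
        = Real.log ((s ^ 2 + (-T - b) ^ 2) / (s ^ 2 + (T - b) ^ 2)) / 2 := by
      intro T
      rw [Real.log_div (hD (-T)).ne' (hD T).ne']
      ring
    simp_rw [e]
    simpa using hlog.div_const 2
  -- conclusion
  simp_rw [hsplit]
  have h1 := (Complex.continuous_ofReal.tendsto _).comp hlim_re
  have h2 := ((Complex.continuous_ofReal.tendsto _).comp hlim_im).mul_const Complex.I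
  have := h1.add h2
  simpa using this

/-- **`∫_{-T}^{T} dω/(iω - μ)^{j+2} → 0`** as `T → ∞` (`Re μ ≠ 0`): the integrand has the
antiderivative `(i/(j+1)) (iω - μ)^{-(j+1)}`, which tends to `0` at `±∞`. [folklore] -/
theorem tendsto_intervalIntegral_inv_I_mul_sub_pow {μ : ℂ} (hμ : μ.re ≠ 0) (j : ℕ) :
    Tendsto (fun T : ℝ => ∫ ω in (-T)..T, ((Complex.I * ω - μ) ^ (j + 2))⁻¹) atTop (𝓝 0) := by
  have hz : ∀ ω : ℝ, Complex.I * ω - μ ≠ 0 := I_mul_sub_ne_zero hμ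
  set F : ℝ → ℂ := fun ω => (Complex.I / (j + 1)) * ((Complex.I * ω - μ) ^ (j + 1))⁻¹ with hF
  have hderiv : ∀ ω : ℝ, HasDerivAt F (((Complex.I * ω - μ) ^ (j + 2))⁻¹) ω := by
    intro ω
    have h0 : HasDerivAt (fun ω : ℝ => Complex.I * ω - μ) Complex.I ω := by
      have := ((hasDerivAt_id ω).ofReal_comp.const_mul Complex.I).sub_const μ
      simpa using this
    have h1 := (h0.pow (j + 1)).inv (pow_ne_zero _ (hz ω))
    have h2 := h1.const_mul (Complex.I / (j + 1))
    refine h2.congr_deriv ?_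
    have hj : ((j : ℂ) + 1) ≠ 0 := Nat.cast_add_one_ne_zero j
    have hzω := hz ω
    simp only [Pi.pow_apply, Nat.add_sub_cancel]
    push_cast
    have hnum : Complex.I * (-(((j : ℂ) + 1) * (Complex.I * ω - μ) ^ j * Complex.I)) =
        ((j : ℂ) + 1) * (Complex.I * ω - μ) ^ j := by
      ring_nf
      rw [Complex.I_sq]
      ring
    rw [div_mul_div_comm, hnum, mul_div_mul_left _ _ hj,
      div_eq_iff (pow_ne_zero _ (pow_ne_zero _ hzω)), inv_mul_eq_div, eq_comm,
      div_eq_iff (pow_ne_zero _ hzω)]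
    ring
  have hcont : Continuous fun ω : ℝ => ((Complex.I * ω - μ) ^ (j + 2))⁻¹ :=
    (((continuous_const.mul Complex.continuous_ofReal).sub continuous_const).pow _).inv₀
      fun ω => pow_ne_zero _ (hz ω)
  have hint : ∀ T : ℝ, ∫ ω in (-T)..T, ((Complex.I * ω - μ) ^ (j + 2))⁻¹ = F T - F (-T) :=
    fun T => integral_eq_sub_of_hasDerivAt (fun x _ => hderiv x) (hcont.intervalIntegrable _ _)
  simp_rw [hint]
  -- `F(±T) → 0`
  have hnorm : ∀ (c : ℝ), c ≠ 0 →
      Tendsto (fun T : ℝ => ((Complex.I * ((c * T : ℝ) : ℂ) - μ) ^ (j + 1))⁻¹) atTop (𝓝 0) := by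
    intro c hc
    refine tendsto_inv₀_cobounded.comp ?_
    rw [← tendsto_norm_atTop_iff_cobounded]
    simp_rw [norm_pow]
    refine (tendsto_pow_atTop (Nat.succ_ne_zero j)).comp ?_
    -- `‖i c T - μ‖ ≥ |c T - Im μ| → ∞`
    have h1 : Tendsto (fun T : ℝ => |c * T - μ.im|) atTop atTop := by
      rcases lt_or_gt_of_ne hc with hc | hc
      · have : Tendsto (fun T : ℝ => c * T - μ.im) atTop atBot :=
          tendsto_atBot_add_const_right _ _ (tendsto_id.const_mul_atTop_of_neg hc)
        exact tendsto_abs_atBot_atTop.comp this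
      · have : Tendsto (fun T : ℝ => c * T - μ.im) atTop atTop :=
          tendsto_atTop_add_const_right _ _ (tendsto_id.const_mul_atTop hc)
        exact tendsto_abs_atTop_atTop.comp this
    refine tendsto_atTop_mono (fun T => ?_) h1
    have := Complex.abs_im_le_norm (Complex.I * ((c * T : ℝ) : ℂ) - μ)
    simpa using this
  have hF : ∀ (c : ℝ), c ≠ 0 → Tendsto (fun T : ℝ => F (c * T)) atTop (𝓝 0) := by
    intro c hc
    have := (hnorm c hc).const_mul (Complex.I / (j + 1))
    simpa [hF] using this
  have h1 := hF 1 one_ne_zero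
  have h2 := hF (-1) (by norm_num)
  simp only [one_mul, neg_mul] at h1 h2
  simpa using h1.sub h2


/-! ### The resolvent on generalized eigenvectors; `∫_{-T}^{T} R(ω) dω → π·1` -/

/-- **Finite expansion of the resolvent on a generalized eigenvector.** If `(A - μ)^k w = 0`
then `R(ω) w = ∑_{j<k} (iω - μ)^{-(j+1)} (A - μ)^j w` (for `iω ≠ μ`). [folklore] -/
theorem IsHurwitz.resolventI_mulVec_of_pow_apply_eq_zero {A : Matrix ι ι ℝ} (hA : IsHurwitz A)
    {μ : ℂ} {ω : ℝ} (hωμ : Complex.I * ω - μ ≠ 0) :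
    ∀ (k : ℕ) (w : ι → ℂ),
      (((Matrix.toLin' (A.map (algebraMap ℝ ℂ))) - μ • 1) ^ k) w = 0 →
        resolventI A ω *ᵥ w = ∑ j ∈ Finset.range k, ((Complex.I * ω - μ) ^ (j + 1))⁻¹ •
          ((((Matrix.toLin' (A.map (algebraMap ℝ ℂ))) - μ • 1) ^ j) w) := by
  set f : Module.End ℂ (ι → ℂ) := Matrix.toLin' (A.map (algebraMap ℝ ℂ)) with hf
  have hf_apply : ∀ v, f v = A.map (algebraMap ℝ ℂ) *ᵥ v := fun v => Matrix.toLin'_apply _ _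
  have hN_apply : ∀ v, (f - μ • 1) v = A.map (algebraMap ℝ ℂ) *ᵥ v - μ • v := fun v => by
    simp [hf_apply]
  intro k
  induction k with
  | zero =>
    intro w hw
    have : w = 0 := by simpa using hw
    simp [this]
  | succ k ih =>
    intro w hw
    set w' := (f - μ • 1) w with hw'
    have hk : ((f - μ • 1) ^ k) w' = 0 := by
      rw [pow_succ, Module.End.mul_apply] at hw
      exact hw
    have h1 := ih w' hk
    -- `R w = (iω - μ)⁻¹ (w + R w')`
    have hkey : resolventI A ω *ᵥ w = (Complex.I * ω - μ)⁻¹ • (w + resolventI A ω *ᵥ w') := by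
      have e : w = resolventI A ω *ᵥ (charLine A ω *ᵥ w) := by
        rw [mulVec_mulVec, hA.resolventI_mul_charLine, one_mulVec]
      have e2 : charLine A ω *ᵥ w = (Complex.I * ω - μ) • w - w' := by
        rw [charLine_mulVec, hw', hN_apply, sub_smul]
        abel
      rw [e2, mulVec_sub, mulVec_smul] at e
      -- `e : w = (iω - μ) • R w - R w'`
      rw [eq_sub_iff_add_eq] at e
      rw [e, inv_smul_smul₀ hωμ]
    rw [hkey, h1, Finset.sum_range_succ', pow_zero, Module.End.one_apply, zero_add, pow_one,
      smul_add, Finset.smul_sum, add_comm]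
    congr 1
    refine Finset.sum_congr rfl fun j _ => ?_
    rw [smul_smul, hw', ← Module.End.mul_apply, ← pow_succ]
    congr 1
    rw [← mul_inv, ← pow_succ']

/-- The symmetric frequency integral `Y_T = ∫_{-T}^{T} R(ω) dω` of the resolvent (entrywise).
[folklore] -/
def resolventIntegral (A : Matrix ι ι ℝ) (T : ℝ) : Matrix ι ι ℂ :=
  Matrix.of fun i j => ∫ ω in (-T)..T, resolventI A ω i j

/-- `Y_T w = ∫_{-T}^{T} R(ω) w dω`. [folklore] -/
theorem IsHurwitz.resolventIntegral_mulVec {A : Matrix ι ι ℝ} (hA : IsHurwitz A) (T : ℝ)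
    (w : ι → ℂ) (i : ι) :
    (resolventIntegral A T *ᵥ w) i = ∫ ω in (-T)..T, (resolventI A ω *ᵥ w) i := by
  simp only [resolventIntegral, mulVec, dotProduct, of_apply]
  rw [intervalIntegral.integral_finsetSum]
  · refine Finset.sum_congr rfl fun j _ => ?_
    rw [intervalIntegral.integral_mul_const]
  · intro j _
    exact ((hA.continuous_resolventI_apply i j).mul continuous_const).intervalIntegrable _ _

/-- On a generalized eigenvector of an eigenvalue with negative real part, `Y_T w → π w`.
[folklore] -/
theorem IsHurwitz.tendsto_resolventIntegral_mulVec_of_mem {A : Matrix ι ι ℝ} (hA : IsHurwitz A)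
    {μ : ℂ} (hμ : μ.re < 0) {k : ℕ} {w : ι → ℂ}
    (hw : (((Matrix.toLin' (A.map (algebraMap ℝ ℂ))) - μ • 1) ^ k) w = 0) :
    Tendsto (fun T : ℝ => resolventIntegral A T *ᵥ w) atTop (𝓝 ((Real.pi : ℂ) • w)) := by
  have hz : ∀ ω : ℝ, Complex.I * ω - μ ≠ 0 := I_mul_sub_ne_zero hμ.ne
  rw [tendsto_pi_nhds]
  intro i
  -- the entry as a finite sum of scalar integrals
  have hrepr : ∀ T : ℝ, (resolventIntegral A T *ᵥ w) i =
      ∑ j ∈ Finset.range k, (∫ ω in (-T)..T, ((Complex.I * ω - μ) ^ (j + 1))⁻¹) *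
        ((((Matrix.toLin' (A.map (algebraMap ℝ ℂ))) - μ • 1) ^ j) w) i := by
    intro T
    rw [hA.resolventIntegral_mulVec]
    have e : ∀ ω : ℝ, (resolventI A ω *ᵥ w) i =
        ∑ j ∈ Finset.range k, ((Complex.I * ω - μ) ^ (j + 1))⁻¹ *
          ((((Matrix.toLin' (A.map (algebraMap ℝ ℂ))) - μ • 1) ^ j) w) i := by
      intro ω
      rw [hA.resolventI_mulVec_of_pow_apply_eq_zero (hz ω) k w hw]
      simp only [Finset.sum_apply, Pi.smul_apply, smul_eq_mul]
    simp_rw [e]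
    rw [intervalIntegral.integral_finsetSum]
    · refine Finset.sum_congr rfl fun j _ => ?_
      rw [intervalIntegral.integral_mul_const]
    · intro j _
      refine (Continuous.mul ?_ continuous_const).intervalIntegrable _ _
      exact (((continuous_const.mul Complex.continuous_ofReal).sub continuous_const).pow _).inv₀
        fun ω => pow_ne_zero _ (hz ω)
  simp_rw [hrepr]
  -- limits of the scalar integrals: `π` for `j = 0`, `0` for `j ≥ 1`
  have hlim : ∀ j : ℕ, Tendsto (fun T : ℝ => ∫ ω in (-T)..T, ((Complex.I * ω - μ) ^ (j + 1))⁻¹)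
      atTop (𝓝 (if j = 0 then (Real.pi : ℂ) else 0)) := by
    intro j
    rcases j with _ | j
    · simp only [zero_add, pow_one, if_true]
      exact tendsto_intervalIntegral_inv_I_mul_sub hμ
    · rw [if_neg (Nat.succ_ne_zero j)]
      exact tendsto_intervalIntegral_inv_I_mul_sub_pow hμ.ne j
  have := tendsto_finsetSum (Finset.range k) fun j (_ : j ∈ Finset.range k) =>
    (hlim j).mul_const (((((Matrix.toLin' (A.map (algebraMap ℝ ℂ))) - μ • 1) ^ j) w) i)
  refine this.congr' (Eventually.of_forall fun T => rfl) |>.trans ?_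
  -- the limit: only `j = 0` survives
  simp only [ite_mul, zero_mul, Finset.sum_ite_eq', Finset.mem_range]
  rcases Nat.eq_zero_or_pos k with hk | hk
  · subst hk
    have : w = 0 := by simpa using hw
    simp [this]
  · rw [if_pos hk]
    simp

/-- **`∫_{-T}^{T} R(ω) v dω → π v` for every vector** (`A` Hurwitz): generalized eigenvectors
span `ℂⁿ`. [folklore] -/
theorem IsHurwitz.tendsto_resolventIntegral_mulVec {A : Matrix ι ι ℝ} (hA : IsHurwitz A)
    (v : ι → ℂ) :
    Tendsto (fun T : ℝ => resolventIntegral A T *ᵥ v) atTop (𝓝 ((Real.pi : ℂ) • v)) := by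
  set f : Module.End ℂ (ι → ℂ) := Matrix.toLin' (A.map (algebraMap ℝ ℂ)) with hf
  have htop : v ∈ ⨆ μ : ℂ, f.maxGenEigenspace μ := by
    rw [Module.End.iSup_maxGenEigenspace_eq_top]
    exact Submodule.mem_top
  refine Submodule.iSup_induction (fun μ : ℂ => f.maxGenEigenspace μ)
    (motive := fun v => Tendsto (fun T : ℝ => resolventIntegral A T *ᵥ v) atTop
      (𝓝 ((Real.pi : ℂ) • v))) htop ?_ ?_ ?_
  · intro μ w hw
    rw [Module.End.mem_maxGenEigenspace] at hw
    obtain ⟨k, hk⟩ := hw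
    by_cases hw0 : w = 0
    · subst hw0
      simp only [mulVec_zero, smul_zero]
      exact tendsto_const_nhds
    · -- `μ` is an eigenvalue, hence `Re μ < 0`
      obtain ⟨u, hu, hfu⟩ := exists_eigenvector_of_pow_apply_eq_zero f μ k w hk hw0
      have hμ : μ.re < 0 := hA μ u hu (by rwa [hf, Matrix.toLin'_apply] at hfu)
      exact hA.tendsto_resolventIntegral_mulVec_of_mem hμ hk
  · simp only [mulVec_zero, smul_zero]
    exact tendsto_const_nhds
  · intro x y hx hy
    simp only [mulVec_add, smul_add]
    exact hx.add hy

/-- **`∫_{-T}^{T} R(ω) dω → π·1` entrywise** (`A` Hurwitz). [folklore] -/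
theorem IsHurwitz.tendsto_resolventIntegral_apply {A : Matrix ι ι ℝ} (hA : IsHurwitz A)
    (i j : ι) :
    Tendsto (fun T : ℝ => resolventIntegral A T i j) atTop
      (𝓝 (if i = j then (Real.pi : ℂ) else 0)) := by
  have h := hA.tendsto_resolventIntegral_mulVec (Pi.single j 1)
  rw [tendsto_pi_nhds] at h
  have h1 := h i
  have e : ∀ T : ℝ, (resolventIntegral A T *ᵥ Pi.single j 1) i = resolventIntegral A T i j := by
    intro T
    simp [mulVec, dotProduct, Pi.single_apply]
  simp_rw [e] at h1
  convert h1 using 2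
  simp [Pi.single_apply]


/-! ### The spectral density `R(ω) S R(ω)*` and its symmetric frequency integral -/

omit [Fintype ι] [DecidableEq ι] in
/-- The conjugate transpose of a complexified real matrix is the complexified transpose.
[folklore] -/
theorem conjTranspose_map_ofReal (A : Matrix ι ι ℝ) :
    (A.map (algebraMap ℝ ℂ))ᴴ = Aᵀ.map (algebraMap ℝ ℂ) := by
  ext i j
  simp [conjTranspose_apply, Complex.conj_ofReal]

/-- The spectral density `F(ω) = R(ω) S R(ω)*` of the stationary solution of
`dx = Ax dt + σ dW`, `S = σσᵀ`. [folklore] -/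
def resolventDensity (A S : Matrix ι ι ℝ) (ω : ℝ) : Matrix ι ι ℂ :=
  resolventI A ω * S.map (algebraMap ℝ ℂ) * (resolventI A ω)ᴴ

/-- The spectral density is continuous in the frequency (`A` Hurwitz). [folklore] -/
theorem IsHurwitz.continuous_resolventDensity {A : Matrix ι ι ℝ} (hA : IsHurwitz A)
    (S : Matrix ι ι ℝ) : Continuous (resolventDensity A S) :=
  (hA.continuous_resolventI.matrix_mul continuous_const).matrix_mul
    hA.continuous_resolventI.matrix_conjTranspose

/-- **Pointwise Lyapunov identity of the spectral density**:
`A F(ω) + F(ω) Aᴴ = -(S R(ω)* + R(ω) S)` (the `iω` terms of the two resolvent identities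
cancel). [folklore] -/
theorem IsHurwitz.lyapunov_resolventDensity {A : Matrix ι ι ℝ} (hA : IsHurwitz A)
    (S : Matrix ι ι ℝ) (ω : ℝ) :
    A.map (algebraMap ℝ ℂ) * resolventDensity A S ω +
        resolventDensity A S ω * (A.map (algebraMap ℝ ℂ))ᴴ =
      -(S.map (algebraMap ℝ ℂ) * (resolventI A ω)ᴴ + resolventI A ω * S.map (algebraMap ℝ ℂ)) := by
  set R := resolventI A ω with hR
  set Sc := S.map (algebraMap ℝ ℂ) with hSc
  set Ac := A.map (algebraMap ℝ ℂ) with hAc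
  have h1 : Ac * R = (Complex.I * ω) • R - 1 := hA.map_mul_resolventI ω
  have h2 : Rᴴ * Acᴴ = (-(Complex.I * ω)) • Rᴴ - 1 := by
    rw [← conjTranspose_mul, h1, conjTranspose_sub, conjTranspose_smul, conjTranspose_one]
    congr 2
    simp [Complex.conj_ofReal]
  calc Ac * resolventDensity A S ω + resolventDensity A S ω * Acᴴ
      = (Ac * R) * Sc * Rᴴ + R * Sc * (Rᴴ * Acᴴ) := by
        simp only [resolventDensity, ← hR, ← hSc, Matrix.mul_assoc]
    _ = ((Complex.I * ω) • R - 1) * Sc * Rᴴ + R * Sc * ((-(Complex.I * ω)) • Rᴴ - 1) := by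
        rw [h1, h2]
    _ = -(Sc * Rᴴ + R * Sc) := by
        rw [sub_mul, sub_mul, smul_mul_assoc, smul_mul_assoc, one_mul, mul_sub, mul_smul_comm,
          mul_one, neg_smul]
        abel

omit [DecidableEq ι] in
/-- Entry of `B ∫F` as an integral. [folklore] -/
theorem intervalIntegral_matrix_mul_left_apply (B : Matrix ι ι ℂ) {F : ℝ → Matrix ι ι ℂ}
    (hF : Continuous F) (a b : ℝ) (i j : ι) :
    ∫ ω in a..b, (B * F ω) i j = ∑ k, B i k * ∫ ω in a..b, F ω k j := by
  simp only [Matrix.mul_apply]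
  rw [intervalIntegral.integral_finsetSum]
  · exact Finset.sum_congr rfl fun k _ => intervalIntegral.integral_const_mul _ _
  · intro k _
    exact (continuous_const.mul (hF.matrix_elem k j)).intervalIntegrable _ _

omit [DecidableEq ι] in
/-- Entry of `(∫F) B` as an integral. [folklore] -/
theorem intervalIntegral_matrix_mul_right_apply (B : Matrix ι ι ℂ) {F : ℝ → Matrix ι ι ℂ}
    (hF : Continuous F) (a b : ℝ) (i j : ι) :
    ∫ ω in a..b, (F ω * B) i j = ∑ k, (∫ ω in a..b, F ω i k) * B k j := by
  simp only [Matrix.mul_apply]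
  rw [intervalIntegral.integral_finsetSum]
  · exact Finset.sum_congr rfl fun k _ => intervalIntegral.integral_mul_const _ _
  · intro k _
    exact ((hF.matrix_elem i k).mul continuous_const).intervalIntegrable _ _

/-- Complex conjugation commutes with interval integrals. [folklore] -/
theorem intervalIntegral_conj (f : ℝ → ℂ) (a b : ℝ) :
    ∫ x in a..b, (starRingEnd ℂ) (f x) = (starRingEnd ℂ) (∫ x in a..b, f x) := by
  simp only [intervalIntegral, integral_conj, map_sub]

/-- The symmetric frequency integral `X_T = ∫_{-T}^{T} R(ω) S R(ω)* dω` (entrywise). [folklore] -/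
def densityIntegral (A S : Matrix ι ι ℝ) (T : ℝ) : Matrix ι ι ℂ :=
  Matrix.of fun i j => ∫ ω in (-T)..T, resolventDensity A S ω i j

/-- **The Lyapunov operator on `X_T`**: `A X_T + X_T Aᴴ = -(S Y_T* + Y_T S)` with
`Y_T = ∫_{-T}^T R`. [folklore] -/
theorem IsHurwitz.lyapunov_densityIntegral {A : Matrix ι ι ℝ} (hA : IsHurwitz A)
    (S : Matrix ι ι ℝ) (T : ℝ) :
    A.map (algebraMap ℝ ℂ) * densityIntegral A S T +
        densityIntegral A S T * (A.map (algebraMap ℝ ℂ))ᴴ =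
      -(S.map (algebraMap ℝ ℂ) * (resolventIntegral A T)ᴴ +
        resolventIntegral A T * S.map (algebraMap ℝ ℂ)) := by
  have hF := hA.continuous_resolventDensity S
  have hR := hA.continuous_resolventI
  have hRH : Continuous fun ω => (resolventI A ω)ᴴ := hR.matrix_conjTranspose
  ext i j
  have hD : ∀ k l, densityIntegral A S T k l = ∫ ω in (-T)..T, resolventDensity A S ω k l :=
    fun k l => rfl
  have hY : ∀ k l, resolventIntegral A T k l = ∫ ω in (-T)..T, resolventI A ω k l :=
    fun k l => rfl
  have hYH : ∀ k l, (resolventIntegral A T)ᴴ k l = ∫ ω in (-T)..T, (resolventI A ω)ᴴ k l := by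
    intro k l
    simp only [conjTranspose_apply, hY, Complex.star_def, ← intervalIntegral_conj]
  calc (A.map (algebraMap ℝ ℂ) * densityIntegral A S T +
          densityIntegral A S T * (A.map (algebraMap ℝ ℂ))ᴴ) i j
      = (∫ ω in (-T)..T, (A.map (algebraMap ℝ ℂ) * resolventDensity A S ω) i j) +
          ∫ ω in (-T)..T, (resolventDensity A S ω * (A.map (algebraMap ℝ ℂ))ᴴ) i j := by
        rw [Matrix.add_apply, Matrix.mul_apply, Matrix.mul_apply,
          intervalIntegral_matrix_mul_left_apply _ hF, intervalIntegral_matrix_mul_right_apply _ hF]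
        simp only [hD]
    _ = ∫ ω in (-T)..T, (A.map (algebraMap ℝ ℂ) * resolventDensity A S ω +
          resolventDensity A S ω * (A.map (algebraMap ℝ ℂ))ᴴ) i j := by
        simp only [Matrix.add_apply]
        rw [intervalIntegral.integral_add]
        · exact ((continuous_const.matrix_mul hF).matrix_elem i j).intervalIntegrable _ _
        · exact ((hF.matrix_mul continuous_const).matrix_elem i j).intervalIntegrable _ _
    _ = ∫ ω in (-T)..T, (-(S.map (algebraMap ℝ ℂ) * (resolventI A ω)ᴴ +
          resolventI A ω * S.map (algebraMap ℝ ℂ))) i j := by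
        refine intervalIntegral.integral_congr fun ω _ => ?_
        rw [hA.lyapunov_resolventDensity S ω]
    _ = -((∫ ω in (-T)..T, (S.map (algebraMap ℝ ℂ) * (resolventI A ω)ᴴ) i j) +
          ∫ ω in (-T)..T, (resolventI A ω * S.map (algebraMap ℝ ℂ)) i j) := by
        simp only [Matrix.neg_apply, Matrix.add_apply, intervalIntegral.integral_neg]
        rw [intervalIntegral.integral_add]
        · exact ((continuous_const.matrix_mul hRH).matrix_elem i j).intervalIntegrable _ _
        · exact ((hR.matrix_mul continuous_const).matrix_elem i j).intervalIntegrable _ _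
    _ = (-(S.map (algebraMap ℝ ℂ) * (resolventIntegral A T)ᴴ +
          resolventIntegral A T * S.map (algebraMap ℝ ℂ))) i j := by
        rw [intervalIntegral_matrix_mul_left_apply _ hRH, intervalIntegral_matrix_mul_right_apply _ hR,
          Matrix.neg_apply, Matrix.add_apply, Matrix.mul_apply, Matrix.mul_apply]
        simp only [hYH, hY]

/-- Real part of the integrated identity: with `X = Re X_T`, `Y = Re Y_T`,
`A X + X Aᵀ = -(S Yᵀ + Y S)`. [folklore] -/
theorem IsHurwitz.lyapunovOp_re_densityIntegral {A : Matrix ι ι ℝ} (hA : IsHurwitz A)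
    (S : Matrix ι ι ℝ) (T : ℝ) :
    lyapunovOp A (Matrix.of fun i j => (densityIntegral A S T i j).re) =
      -(S * (Matrix.of fun i j => (resolventIntegral A T i j).re)ᵀ +
        (Matrix.of fun i j => (resolventIntegral A T i j).re) * S) := by
  have h := hA.lyapunov_densityIntegral S T
  ext i j
  have hij := congrArg Complex.re (congrFun (congrFun h i) j)
  simp only [Matrix.add_apply, Matrix.mul_apply, Matrix.neg_apply, map_apply, conjTranspose_apply,
    Complex.coe_algebraMap, Complex.star_def, Complex.conj_ofReal, Complex.add_re, Complex.neg_re,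
    Complex.re_sum, Complex.re_ofReal_mul, Complex.re_mul_ofReal, Complex.conj_re] at hij
  simp only [lyapunovOp_apply, Matrix.add_apply, Matrix.mul_apply, Matrix.neg_apply, transpose_apply,
    of_apply]
  rw [hij]

/-- **The frequency-domain solution of the Lyapunov equation.** For a Hurwitz matrix `A` and
any real `S`, entrywise
`Re ∫_{-T}^{T} (R(ω) S R(ω)*)_{ij} dω → 2π (lyapSol A S)_{ij}` as `T → ∞`, i.e.
`lyapSol A S = (1/2π) ∫_ℝ (iω - A)⁻¹ S (iω - A)^{-*} dω` as a symmetric improper integral.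
[folklore] -/
theorem IsHurwitz.tendsto_re_densityIntegral {A : Matrix ι ι ℝ} (hA : IsHurwitz A)
    (S : Matrix ι ι ℝ) (i j : ι) :
    Tendsto (fun T : ℝ => (densityIntegral A S T i j).re) atTop
      (𝓝 (2 * Real.pi * lyapSol A S i j)) := by
  -- the real parts as real matrices
  set X : ℝ → Matrix ι ι ℝ := fun T => Matrix.of fun i j => (densityIntegral A S T i j).re with hX
  set Y : ℝ → Matrix ι ι ℝ := fun T => Matrix.of fun i j => (resolventIntegral A T i j).re with hY
  -- `Y_T → π·1`
  have hYlim : Tendsto Y atTop (𝓝 (Real.pi • (1 : Matrix ι ι ℝ))) := by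
    refine tendsto_pi_nhds.mpr fun k => tendsto_pi_nhds.mpr fun l => ?_
    have h := (Complex.continuous_re.tendsto _).comp (hA.tendsto_resolventIntegral_apply k l)
    have e : (if k = l then (Real.pi : ℂ) else 0).re = (Real.pi • (1 : Matrix ι ι ℝ)) k l := by
      simp only [Matrix.smul_apply, one_apply, smul_eq_mul, mul_ite, mul_one, mul_zero]
      split_ifs <;> simp
    rw [← e]
    exact h
  -- the right-hand sides converge to `-2π S`
  set Φ : Matrix ι ι ℝ → Matrix ι ι ℝ := fun Z => -(S * Zᵀ + Z * S) with hΦ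
  have hΦc : Continuous Φ :=
    ((continuous_const.matrix_mul continuous_id.matrix_transpose).add
      (continuous_id.matrix_mul continuous_const)).neg
  have hΦlim : Tendsto (fun T => Φ (Y T)) atTop (𝓝 (-((2 * Real.pi) • S))) := by
    have h := (hΦc.tendsto _).comp hYlim
    have e : Φ (Real.pi • (1 : Matrix ι ι ℝ)) = -((2 * Real.pi) • S) := by
      simp only [hΦ, transpose_smul, transpose_one, Matrix.mul_smul, Matrix.mul_one,
        Matrix.smul_mul, Matrix.one_mul]
      rw [← two_smul ℝ (Real.pi • S), smul_smul]
    rw [← e]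
    exact h
  -- invert the Lyapunov operator
  have hbij := hA.lyapunovOp_bijective
  set L := LinearEquiv.ofBijective (lyapunovOp A) hbij with hL
  have hLX : ∀ T, X T = L.symm (Φ (Y T)) := by
    intro T
    rw [LinearEquiv.eq_symm_apply]
    show lyapunovOp A (X T) = Φ (Y T)
    exact hA.lyapunovOp_re_densityIntegral S T
  have hLc : Continuous (L.symm : Matrix ι ι ℝ →ₗ[ℝ] Matrix ι ι ℝ) :=
    LinearMap.continuous_of_finiteDimensional _
  have hXlim : Tendsto X atTop (𝓝 (L.symm (-((2 * Real.pi) • S)))) := by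
    have h := (hLc.tendsto _).comp hΦlim
    refine h.congr fun T => ?_
    simp only [Function.comp_apply, hLX]
    rfl
  have hsol : L.symm (-((2 * Real.pi) • S)) = (2 * Real.pi) • lyapSol A S := by
    rw [lyapSol, dif_pos hbij, ← hL, ← smul_neg, LinearEquiv.map_smul]
  rw [hsol] at hXlim
  have h1 := tendsto_pi_nhds.mp hXlim i
  have h2 := tendsto_pi_nhds.mp h1 j
  simp only [hX, of_apply, Matrix.smul_apply, smul_eq_mul] at h2
  exact h2

/-- Diagonal entries of the spectral density of a diagonal `S = diag(d)`:
`(R diag(d) R*)_{ii} = ∑_k d_k |R_{ik}|²`. [folklore] -/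
theorem resolventDensity_diagonal_apply_self (A : Matrix ι ι ℝ) (d : ι → ℝ) (ω : ℝ) (i : ι) :
    resolventDensity A (Matrix.diagonal d) ω i i =
      ((∑ k, d k * Complex.normSq (resolventI A ω i k) : ℝ) : ℂ) := by
  have hmap : (Matrix.diagonal d).map (algebraMap ℝ ℂ) = Matrix.diagonal fun k => (d k : ℂ) := by
    rw [Matrix.diagonal_map (map_zero _)]
    rfl
  rw [resolventDensity, hmap, Matrix.mul_apply]
  push_cast
  refine Finset.sum_congr rfl fun k _ => ?_
  rw [mul_diagonal, conjTranspose_apply, Complex.star_def, Complex.normSq_eq_conj_mul_self]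
  ring

/-- **Frequency integral of a diagonal stationary variance.** For Hurwitz `A` and
`S = diag(d)` with `d ≥ 0`, the function `ω ↦ ∑_k d_k |R(ω)_{ik}|²` is integrable on `ℝ` and
`∫_ℝ ∑_k d_k |R(ω)_{ik}|² dω = 2π (lyapSol A S)_{ii}`. [folklore] -/
theorem IsHurwitz.integral_resolvent_diagonal {A : Matrix ι ι ℝ} (hA : IsHurwitz A)
    (d : ι → ℝ) (hd : ∀ k, 0 ≤ d k) (i : ι) :
    Integrable (fun ω : ℝ => ∑ k, d k * Complex.normSq (resolventI A ω i k)) ∧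
      ∫ ω, ∑ k, d k * Complex.normSq (resolventI A ω i k) =
        2 * Real.pi * lyapSol A (Matrix.diagonal d) i i := by
  set f : ℝ → ℝ := fun ω => ∑ k, d k * Complex.normSq (resolventI A ω i k) with hf
  have hfc : Continuous f :=
    continuous_finsetSum _ fun k _ =>
      continuous_const.mul (Complex.continuous_normSq.comp (hA.continuous_resolventI_apply i k))
  have hfnn : ∀ ω, 0 ≤ f ω := fun ω =>
    Finset.sum_nonneg fun k _ => mul_nonneg (hd k) (Complex.normSq_nonneg _)
  have hre : ∀ T : ℝ, (densityIntegral A (Matrix.diagonal d) T i i).re = ∫ ω in (-T)..T, f ω := by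
    intro T
    simp only [densityIntegral, of_apply, resolventDensity_diagonal_apply_self,
      intervalIntegral.integral_ofReal, Complex.ofReal_re, hf]
  have hlim : Tendsto (fun T : ℝ => ∫ ω in (-T)..T, f ω) atTop
      (𝓝 (2 * Real.pi * lyapSol A (Matrix.diagonal d) i i)) := by
    have h := hA.tendsto_re_densityIntegral (Matrix.diagonal d) i i
    simp_rw [hre] at h
    exact h
  have hint : Integrable f := by
    refine integrable_of_intervalIntegral_norm_tendsto (2 * Real.pi * lyapSol A (Matrix.diagonal d) i i)
      (fun T => (hfc.integrableOn_Ioc)) tendsto_neg_atTop_atBot tendsto_id ?_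
    refine hlim.congr fun T => ?_
    refine intervalIntegral.integral_congr fun ω _ => ?_
    exact (Real.norm_of_nonneg (hfnn ω)).symm
  refine ⟨hint, ?_⟩
  exact tendsto_nhds_unique (intervalIntegral_tendsto_integral hint tendsto_neg_atTop_atBot tendsto_id)
    hlim


/-! ### Bridge to Mathlib's `resolvent` -/

/-- `resolventI` is Mathlib's `resolvent` of the complexified matrix at the spectral parameter
`iω` (so `lean search resolvent` finds this file; the matrix-inverse form is kept for the
`adjugate/det` continuity proof). [folklore] -/
theorem resolventI_eq_resolvent (A : Matrix ι ι ℝ) (ω : ℝ) :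
    resolventI A ω = resolvent (A.map (algebraMap ℝ ℂ)) (Complex.I * ω) := by
  unfold resolventI charLine resolvent
  rw [Matrix.nonsing_inv_eq_ringInverse, Algebra.algebraMap_eq_smul_one]

end Literature.MathematicalPhysics.KineticTheory.HeatConduction

end
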